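import Mathlib.Analysis.InnerProductSpace.PiL2
import Mathlib.Analysis.Calculus.FDeriv.Equiv
import Mathlib.Analysis.Calculus.FDeriv.Add
import Mathlib.MeasureTheory.Measure.Haar.NormedSpace
import Mathlib.MeasureTheory.Measure.Haar.InnerProductSpace
import Mathlib.MeasureTheory.Group.Integral
import Mathlib.MeasureTheory.Integral.Bochner.Set
import HarnessLib

/-!
# The blow-down rescaling of the Dirichlet energy on `EuclideanSpace ℝ (Fin 3)`: `x ↦ c + R • x` costs exactly `R⁻¹`
# (K2 organ `hImproveCoreFlat`, road R1 ∕ LINE 25 `stub_latticeToContinuumLimit` (Γ1): the normalisation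
# «lattice energy `≤ Λ₀·R`» ↔ «continuum energy `≤ Λ₀` at unit scale»; cell ym3-torus, seat px7 g7)

Helper toward crux `stmt-QuantumFields-19936` (`Summit.QuantumFields.YangMills.Theses.UnitScaleTilt.HistoryTailL`).  Mathlib only;
generic in the map `I : EuclideanSpace ℝ (Fin 3) → E` (no differentiability assumed — Mathlib's `fderiv` is `0` off the
differentiability set on BOTH sides, consistently, because `x ↦ c + R • x` is an affine equivalence).  Companion of
`PoincareLipschitzKuhnEnergy.bondEnergy_le_integral_bigBox_le_bondEnergy` (lattice energy of `u` on `box z (R∓1)` sandwiches the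
mesh-one energy of its interpolant): composing with this file turns the organ's bound `E(box z R) ≤ Λ₀·R` into the unit-scale bound
`∫_{|x| < s} ∑_i ‖∂_i (I ∘ (c + R•·))‖² ≤ Λ₀ + (boundary layer)∕R` that LINE 25's blow-down sequence carries.

* `fderiv_comp_affine_apply_single` — `fderiv (x ↦ I (c + R • x)) x eᵢ = R • fderiv I (c + R • x) eᵢ` (`R ≠ 0`), from
  `ContinuousLinearEquiv.comp_right_fderiv` (homothety `ContinuousLinearEquiv.smulLeft`) and `fderiv_comp_add_left`;
* `energyDensity_comp_affine` — the energy density in LINE 25's letters scales by `R²` pointwise;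
* ★★ `integral_cube_energyDensity_rescale` — for `0 < R`:
  `∫_{x | ∀ i, |x i| < s} ∑_i ‖fderiv ℝ (x ↦ I (c + R • x)) x (single i 1)‖² = R⁻¹ · ∫_{X | ∀ i, c i − R s < X i < c i + R s} ∑_i ‖fderiv ℝ I X (single i 1)‖²`
  (`setIntegral_comp_smul_of_pos` with `finrank = 3`, translation invariance `integral_add_left_eq_self` through indicators).

HONEST: calculus bookkeeping; nothing of `stub_latticeToContinuumLimit`, `hImproveCoreFlat`, K1, `MeanDeviationL`, `BlockLipschitzL`,
`HistoryTailL` is proved; YM₃ on T³ is ladder rung R3 — not d = 4, not infinite volume, not a mass gap, not Clay.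
-/

open scoped BigOperators Pointwise
open MeasureTheory

noncomputable section

namespace Summit.QuantumFields.YangMills.Theorems.PoincareLipschitzBlowDownRescale

variable {E : Type*} [NormedAddCommGroup E] [NormedSpace ℝ E]

/-- The derivative of `x ↦ I (c + R • x)` in a coordinate direction is `R` times that of `I` at the image point — for EVERY `x`
(both sides vanish together off the differentiability set). -/
theorem fderiv_comp_affine_apply (I : EuclideanSpace ℝ (Fin 3) → E) (c : EuclideanSpace ℝ (Fin 3)) {R : ℝ} (hR : R ≠ 0)
    (x v : EuclideanSpace ℝ (Fin 3)) :
    fderiv ℝ (fun x : EuclideanSpace ℝ (Fin 3) => I (c + R • x)) x v = R • fderiv ℝ I (c + R • x) v := by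
  let iso : EuclideanSpace ℝ (Fin 3) ≃L[ℝ] EuclideanSpace ℝ (Fin 3) := ContinuousLinearEquiv.smulLeft (Units.mk0 R hR)
  have hiso : ∀ y : EuclideanSpace ℝ (Fin 3), iso y = R • y := fun y => by
    simp [iso, ContinuousLinearEquiv.smulLeft_apply_apply, Units.smul_def]
  have hcomp : (fun x : EuclideanSpace ℝ (Fin 3) => I (c + R • x)) = (fun y => I (c + y)) ∘ iso := by
    funext y; simp [Function.comp, hiso]
  rw [hcomp, iso.comp_right_fderiv, ContinuousLinearMap.comp_apply, fderiv_comp_add_left]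
  simp only [ContinuousLinearEquiv.coe_coe, hiso, map_smul]

/-- ★ The energy density (LINE 25's letters) of `x ↦ I (c + R • x)` is `R²` times that of `I` at the image point. -/
theorem energyDensity_comp_affine (I : EuclideanSpace ℝ (Fin 3) → E) (c : EuclideanSpace ℝ (Fin 3)) {R : ℝ} (hR : R ≠ 0)
    (x : EuclideanSpace ℝ (Fin 3)) :
    ∑ i : Fin 3, ‖fderiv ℝ (fun x : EuclideanSpace ℝ (Fin 3) => I (c + R • x)) x (EuclideanSpace.single i (1:ℝ))‖ ^ 2 =
      R ^ 2 * ∑ i : Fin 3, ‖fderiv ℝ I (c + R • x) (EuclideanSpace.single i (1:ℝ))‖ ^ 2 := by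
  rw [Finset.mul_sum]
  refine Finset.sum_congr rfl fun i _ => ?_
  rw [fderiv_comp_affine_apply I c hR, norm_smul, mul_pow, Real.norm_eq_abs, sq_abs]

/-- The scaled centred cube: `R • {x | ∀ i, |x i| < s} = {y | ∀ i, |y i| < R s}` for `0 < R`. -/
theorem smul_centredCube {R : ℝ} (hR : 0 < R) (s : ℝ) :
    R • {x : EuclideanSpace ℝ (Fin 3) | ∀ i, |x i| < s} = {y : EuclideanSpace ℝ (Fin 3) | ∀ i, |y i| < R * s} := by
  ext y
  rw [Set.mem_smul_set_iff_inv_smul_mem₀ hR.ne']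
  simp only [Set.mem_setOf_eq, PiLp.smul_apply, smul_eq_mul]
  constructor
  · intro h i
    have := h i
    rw [abs_mul, abs_inv, abs_of_pos hR] at this
    rwa [inv_mul_lt_iff₀ hR] at this
  · intro h i
    rw [abs_mul, abs_inv, abs_of_pos hR, inv_mul_lt_iff₀ hR]
    exact h i

/-- The translated scaled cube is the box `{X | ∀ i, c i − R s < X i < c i + R s}`: membership of `c + y`. -/
theorem add_mem_box_iff (c y : EuclideanSpace ℝ (Fin 3)) (R s : ℝ) :
    (c + y ∈ {X : EuclideanSpace ℝ (Fin 3) | ∀ i, c i - R * s < X i ∧ X i < c i + R * s}) ↔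
      y ∈ {y : EuclideanSpace ℝ (Fin 3) | ∀ i, |y i| < R * s} := by
  simp only [Set.mem_setOf_eq, PiLp.add_apply, abs_lt]
  constructor
  · intro h i; have := h i; constructor <;> linarith [this.1, this.2]
  · intro h i; have := h i; constructor <;> linarith [this.1, this.2]

/-- The centred cube `{y | ∀ i, |y i| < t}` is measurable (it is open). -/
theorem measurableSet_centredCube (t : ℝ) :
    MeasurableSet {y : EuclideanSpace ℝ (Fin 3) | ∀ i, |y i| < t} := by
  have hc : ∀ i : Fin 3, Continuous fun x : EuclideanSpace ℝ (Fin 3) => x i := fun i =>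
    (EuclideanSpace.proj i).continuous
  have : IsOpen {y : EuclideanSpace ℝ (Fin 3) | ∀ i, |y i| < t} := by
    rw [Set.setOf_forall]
    exact isOpen_iInter_of_finite fun i => isOpen_lt (continuous_abs.comp (hc i)) continuous_const
  exact this.measurableSet

/-- The box `{X | ∀ i, c i − R s < X i < c i + R s}` is measurable (it is open). -/
theorem measurableSet_box (c : EuclideanSpace ℝ (Fin 3)) (R s : ℝ) :
    MeasurableSet {X : EuclideanSpace ℝ (Fin 3) | ∀ i, c i - R * s < X i ∧ X i < c i + R * s} := by
  have hc : ∀ i : Fin 3, Continuous fun x : EuclideanSpace ℝ (Fin 3) => x i := fun i =>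
    (EuclideanSpace.proj i).continuous
  have : IsOpen {X : EuclideanSpace ℝ (Fin 3) | ∀ i, c i - R * s < X i ∧ X i < c i + R * s} := by
    rw [Set.setOf_forall]
    exact isOpen_iInter_of_finite fun i => (isOpen_lt continuous_const (hc i)).and (isOpen_lt (hc i) continuous_const)
  exact this.measurableSet

/-- ★★ THE BLOW-DOWN RESCALING OF THE DIRICHLET ENERGY: for `0 < R`,
`∫_{|x i| < s} ∑_i ‖∂_i (I ∘ (c + R•·))‖² = R⁻¹ · ∫_{c i − R s < X i < c i + R s} ∑_i ‖∂_i I‖²`. -/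
theorem integral_cube_energyDensity_rescale (I : EuclideanSpace ℝ (Fin 3) → E) (c : EuclideanSpace ℝ (Fin 3)) {R : ℝ}
    (hR : 0 < R) (s : ℝ) :
    ∫ x in {x : EuclideanSpace ℝ (Fin 3) | ∀ i, |x i| < s},
        ∑ i : Fin 3, ‖fderiv ℝ (fun x : EuclideanSpace ℝ (Fin 3) => I (c + R • x)) x (EuclideanSpace.single i (1:ℝ))‖ ^ 2 =
      R⁻¹ * ∫ X in {X : EuclideanSpace ℝ (Fin 3) | ∀ i, c i - R * s < X i ∧ X i < c i + R * s},
        ∑ i : Fin 3, ‖fderiv ℝ I X (EuclideanSpace.single i (1:ℝ))‖ ^ 2 := by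
  set g : EuclideanSpace ℝ (Fin 3) → ℝ := fun X => ∑ i : Fin 3, ‖fderiv ℝ I X (EuclideanSpace.single i (1:ℝ))‖ ^ 2 with hg
  -- pointwise rescaling of the density
  have hpt : ∀ x, ∑ i : Fin 3, ‖fderiv ℝ (fun x : EuclideanSpace ℝ (Fin 3) => I (c + R • x)) x
      (EuclideanSpace.single i (1:ℝ))‖ ^ 2 = R ^ 2 * (fun y => g (c + y)) (R • x) := fun x => by
    simp only [hg]; exact energyDensity_comp_affine I c hR.ne' x
  simp_rw [hpt]
  rw [integral_const_mul, Measure.setIntegral_comp_smul_of_pos volume (fun y => g (c + y)) _ hR,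
    finrank_euclideanSpace_fin, smul_centredCube hR s, smul_eq_mul]
  -- translate: `∫_{|y| < Rs} g (c + y) = ∫_{box} g`
  have htr : ∫ y in {y : EuclideanSpace ℝ (Fin 3) | ∀ i, |y i| < R * s}, g (c + y) =
      ∫ X in {X : EuclideanSpace ℝ (Fin 3) | ∀ i, c i - R * s < X i ∧ X i < c i + R * s}, g X := by
    rw [← integral_indicator (measurableSet_centredCube (R * s)), ← integral_indicator (measurableSet_box c R s)]
    have hind : (fun y => Set.indicator {y : EuclideanSpace ℝ (Fin 3) | ∀ i, |y i| < R * s} (fun y => g (c + y)) y) =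
        fun y => Set.indicator {X : EuclideanSpace ℝ (Fin 3) | ∀ i, c i - R * s < X i ∧ X i < c i + R * s} g (c + y) := by
      funext y
      by_cases hy : y ∈ {y : EuclideanSpace ℝ (Fin 3) | ∀ i, |y i| < R * s}
      · rw [Set.indicator_of_mem hy, Set.indicator_of_mem ((add_mem_box_iff c y R s).mpr hy)]
      · rw [Set.indicator_of_notMem hy, Set.indicator_of_notMem (fun h => hy ((add_mem_box_iff c y R s).mp h))]
    rw [hind]
    exact integral_add_left_eq_self
      (Set.indicator {X : EuclideanSpace ℝ (Fin 3) | ∀ i, c i - R * s < X i ∧ X i < c i + R * s} g) c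
  rw [htr]
  have hR3 : (R ^ 3)⁻¹ * (R ^ 2) = R⁻¹ := by field_simp
  rw [← mul_assoc, mul_comm (R ^ 2), hR3]

end Summit.QuantumFields.YangMills.Theorems.PoincareLipschitzBlowDownRescale
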